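import Summits.Ventures.HSemireg.WedgeHankelDivisorIntersection

/-!
# Venture HSemireg — THE P¹ VERSION: the Siegel ideal is cut out by the node kernels of any divisor ON P¹ of total order `≥ k + 1` (a node at `∞` of order `P∞ + 1` among
# the finite nodes), in every degree; dually the co-Siegel space is the sum of the node images, direct for total order exactly `k + 1` — F3b / F3c / F6 on P¹ without
# `D ≤ n + 1 − k` / `2k ≤ n`

HONEST FRAMING. Part of the Lean index of the computation cell `pub-hsemireg` (seat p10 gen 17, Sunday typer «UNIFORM-IN-n»).
Finite-dimensional EXTERIOR ALGEBRA over a field ONLY: no variety, no cohomology theory, no sheaf, no Ext group, no semiregularity map;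
nothing here says that HC / HC_CM / HC_AV holds; no Literature fact is declared or used.  Custodian versions as in `WedgeHankelSiegelIdeal` (1/3) and
`WedgeKernelDuality`; the dictionary (`Θ^t e^{λΘ}/t! ↦ w_n(expMul λ δ_t)`; the node at `∞` of order `P∞+1` ↦ the top window / `w_n(rev_n q∞)`; the divisor
`Σ_i (P_i+1)[λ_i] + (P∞+1)[∞]`) is QUOTED, never asserted.

WHAT IS IN THE TREE.  F3b `Kr_w_expMul_sum_add_rev` (the kernel of ONE P¹ divisor class is the intersection of its node kernels) and F3c (`= SI_k` once `D ≥ k + 1`), both under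
`D ≤ n + 1 − k`; F6 `coSiegel_eq_iSup_V_sup_V_rev` (`2k ≤ n`); G4 `WedgeHankelDivisorIntersection` (this seat): finite divisors, every degree, by module-valued Hermite interpolation
on the top-x-count components `u_a = θ_a ∧ E_a`.  A node at `∞` does not enter that Hermite system through the top-x-count block; instead **its node classes `E_{n−t} = w_n(δ_{n−t})`,
`t ≤ P∞`, kill the TOP coefficients `u_k, …, u_{k−P∞}` directly** (gen 11's block law on `plane(k−t, t)`, window entry at `s = n − k`), after which the finite nodes interpolate the
remaining `k − P∞` coefficients.  THIS FILE (namespace `Summit.Ventures.HSemireg.Wedge.KernelDuality` continued; imports G4):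
* §94 `yRich_anti`; `sup_yRich_le_Kr_w_spike_top` (the order-`(P∞+1)` kernel at `∞` lies in the kernel of each `E_{n−t}`, `t ≤ P∞`; E4); **`prj_mem_siegelIdeal_of_mul_spike_top`**:
  `θ ∈ ⋀^k`, `θ ∧ E_{n−t} = 0`, `t ≤ k ≤ n` ⇒ the component `θ_{k−t}` is isotropic.
* §95 **`mem_siegelIdeal_of_forall_mul_node_top_eq_zero`**: `θ ∈ ⋀^k` (`k ≤ n`) killed by the node classes `w_n(expMul λ_i δ_t)` (`t ≤ P_i`, distinct `λ_i`) and by `E_{n−t}`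
  (`t ≤ P∞`) with `Σ_i (P_i+1) + (P∞+1) ≥ k + 1` lies in `SI_k`; the NAMED form **`iInf_sup_inf_sup_yRich_eq_siegelIdeal`:
  `(⋂_i (SI_k ⊔ Φs λ_i (xRich(k,P_i)))) ⊓ (SI_k ⊔ yRich(k,P∞)) = SI_k`** (`k + P_i ≤ n`, `k + P∞ ≤ n`) — F3b's intersection with NO `D ≤ n + 1 − k`; the class form
  **`iInf_Kr_w_expMul_inf_Kr_w_rev_eq_siegelIdeal`** (exact orders; the node at `∞` as `w_n(rev_n q∞)`).
* §96 THE DUAL: `iSupIndep_of_finrank_iSup_eq_sum` (generic: a finite family whose sum has dimension `Σ dim` is independent); **`coSiegel_eq_iSup_V_sup_V_rev'`: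
  `coSiegel(k′+n) = (⨆_i V(univ, w_n(expMul λ_i q_i), k′)) ⊔ V(univ, w_n(rev_n q∞), k′)`** (`k + k′ = n`, exact orders `≤ k′`, total order `≥ k + 1`); for total order EXACTLY `k + 1`:
  the finite part is direct (`iSupIndep`), has dimension `D_f·C(n,k)`, and meets the `∞` part in `0` (`coSiegel_decomposition_top`) — F6's P¹ decomposition in every degree.
NOT typed here: the kernel of the P¹ divisor CLASS itself in the mirror range (strictly between `SI_k` and the intersection); anything Ext-side.  Class side only; new names only.
-/

open Module

namespace Summit.Ventures.HSemireg.Wedge.KernelDuality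

open Summit.Ventures.HSemireg.Wedge Summit.Ventures.HSemireg.Wedge.Kunneth Summit.Ventures.HSemireg.Wedge.Hankel
  Summit.Ventures.HSemireg.Wedge.HankelSiegel Summit.Ventures.HSemireg.Wedge.HankelSiegelIdeal Summit.Ventures.HSemireg.Wedge.KunnethKernel
  Summit.Ventures.HSemireg.Wedge.HankelSecant Summit.Ventures.HSemireg.Wedge.HankelFrameChange Summit.Ventures.HSemireg.Wedge.HankelPureKernel

variable (K : Type*) [Field K] {n : ℕ}

/-! ## §94. The node at `∞` kills the top coefficients -/

/-- `yRich(k, ·)` is antitone in the letter bound. -/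
lemma yRich_anti {k P P' : ℕ} (h : P ≤ P') : yRich K n k P' ≤ yRich K n k P :=
  iSup₂_le fun b hb => plane_le_yRich K (by have := (Finset.mem_Ioc.mp hb).1; omega) (Finset.mem_Ioc.mp hb).2

/-- the order-`(P∞+1)` kernel at `∞` lies in the kernel of each of its node classes `E_{n−t}`: `SI_k ⊔ yRich(k, P∞) ≤ Kr(univ, E_{n−t}, k)` for `t ≤ P∞`, `k + t ≤ n` (E4). -/
lemma sup_yRich_le_Kr_w_spike_top {k Pinf t : ℕ} (ht : t ≤ Pinf) (hkt : k + t ≤ n) :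
    siegelIdeal K n k ⊔ yRich K n k Pinf ≤ Kr K Finset.univ (w K n n (fun j => if j = n - t then (1 : K) else 0)) k := by
  rw [Kr_w_eq_of_order_top K (P := t) hkt (fun j hj => if_neg (by omega)) (by rw [if_pos rfl]; exact one_ne_zero)]
  exact sup_le_sup_left (yRich_anti K ht) _

/-- **THE NODE CLASS `E_{n−t}` AT `∞` KILLS THE COMPONENT `θ_{k−t}`**: `θ ∈ ⋀^k`, `t ≤ k ≤ n`, `θ ∧ E_{n−t} = 0` ⇒ `prj (k−t) t θ ∈ SI_k` — on the block `plane(k−t, t)` the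
window of `δ_{n−t}` has its non-zero entry at `s = n − k` (gen 11's block law). -/
theorem prj_mem_siegelIdeal_of_mul_spike_top {k t : ℕ} (hk : k ≤ n) (htk : t ≤ k) {θ : HT K (In n)} (hθ : θ ∈ ⋀[K]^k (In n → K))
    (h0 : θ * w K n n (fun j => if j = n - t then (1 : K) else 0) = 0) : prj K n (k - t) t θ ∈ siegelIdeal K n k := by
  have hE : prj K n (k - t) (k - (k - t)) θ * w K n n (fun j => if j = n - t then (1 : K) else 0) = 0 :=
    (mul_w_spike_eq_zero_iff K (p := n - t) (by omega) hθ).mp h0 (k - t) (by omega)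
  rw [show k - (k - t) = t by omega] at hE
  have hker : (⟨prj K n (k - t) t θ, prj_mem_plane K (k - t) t θ⟩ : plane K n (k - t) t) ∈
      LinearMap.ker (wedgeP K n (k - t) t (fun j => if j = n - t then (1 : K) else 0)) := by
    rw [LinearMap.mem_ker, wedgeP, LinearMap.comp_apply, Submodule.subtype_apply, LinearMap.mulRight_apply]; exact hE
  rw [ker_wedgeP_of_window_ne K (s := n - k) (by omega) (by rw [if_pos (by omega)]; exact one_ne_zero),
    Submodule.mem_comap, Submodule.subtype_apply, show k - t + t = k by omega] at hker
  exact hker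

/-! ## §95. The Siegel ideal is cut out by the node kernels of any divisor on `P¹` of total order `≥ k + 1` -/

/-- **`θ ∈ ⋀^k` (`k ≤ n`) killed by the node classes of a divisor on `P¹` of total order `≥ k + 1` is isotropic**: distinct finite `λ_i` with `θ ∧ w_n(expMul λ_i δ_t) = 0` for
`t ≤ P_i`, and `θ ∧ E_{n−t} = 0` for `t ≤ P∞`, `Σ_i (P_i+1) + (P∞+1) ≥ k + 1` ⇒ `θ ∈ SI_k` (the `∞`-classes kill `θ_a` for `a ≥ k − P∞`, §94; the finite nodes interpolate the
module-valued polynomial `Σ_{a < k−P∞} (θ_a ∧ E_a) X^a`, G4 §91). -/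
theorem mem_siegelIdeal_of_forall_mul_node_top_eq_zero {k r : ℕ} (hk : k ≤ n) {lam : Fin r → K} (hlam : Function.Injective lam) {P : Fin r → ℕ} {Pinf : ℕ}
    (hD : k + 1 ≤ (∑ i, (P i + 1)) + (Pinf + 1)) {θ : HT K (In n)} (hθ : θ ∈ ⋀[K]^k (In n → K))
    (h0 : ∀ (i : Fin r) (t : Fin (P i + 1)), θ * w K n n (expMul K (lam i) (fun j => if j = (t : ℕ) then (1 : K) else 0)) = 0)
    (hinf : ∀ t, t ≤ Pinf → θ * w K n n (fun j => if j = n - t then (1 : K) else 0) = 0) : θ ∈ siegelIdeal K n k := by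
  -- the top coefficients: θ_a ∈ SI_k for k − Pinf ≤ a ≤ k
  have htop : ∀ a, a ≤ k → k ≤ a + Pinf → prj K n a (k - a) θ ∈ siegelIdeal K n k := by
    intro a hak haP
    have := prj_mem_siegelIdeal_of_mul_spike_top K hk (t := k - a) (by omega) hθ (hinf (k - a) (by omega))
    rwa [show k - (k - a) = a by omega] at this
  -- the low coefficients: module-valued Hermite interpolation at the finite nodes, on c = k − Pinf unknowns
  set c := k - Pinf with hc
  have hcD : c ≤ ∑ i, (P i + 1) := by omega
  set u : Fin c → HT K (In n) := fun l => prj K n l (k - l) θ * w K n n (fun j => if j = (l : ℕ) then (1 : K) else 0) with hu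
  have hsys : ∀ x : DIdx P, ∑ l : Fin c, cvMat K lam P c x l • u l = 0 := by
    rintro ⟨i, t⟩
    have h1 := congrArg (prj K n n k) (h0 i t)
    rw [map_zero, prj_top_mul_w K hk _ hθ] at h1
    -- the terms a ≥ c vanish (θ_a isotropic), the rest is the c-truncated system
    rw [← Finset.sum_subset (Finset.range_subset_range.mpr (show c ≤ k + 1 by omega))] at h1
    · rw [Finset.sum_range] at h1
      rw [← h1]
      refine Finset.sum_congr rfl fun l _ => ?_
      rw [cvMat_apply, expMul_spike_apply]
    · intro a ha hac
      rw [Finset.mem_range] at ha hac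
      rw [mul_w_eq_zero_of_mem_siegelIdeal K (htop a (by omega) (by omega)), smul_zero]
  have hua := eq_zero_of_forall_cvMat_smul_sum_eq_zero K hlam P hcD hsys
  rw [← sum_prj K hθ]
  refine Submodule.sum_mem _ fun a ha => ?_
  rw [Finset.mem_range] at ha
  by_cases hac : c ≤ a
  · exact htop a (by omega) (by omega)
  · have hE : prj K n a (k - a) θ * w K n n (fun j => if j = a then (1 : K) else 0) = 0 := hua ⟨a, by omega⟩
    have hker : (⟨prj K n a (k - a) θ, prj_mem_plane K a (k - a) θ⟩ : plane K n a (k - a)) ∈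
        LinearMap.ker (wedgeP K n a (k - a) (fun j => if j = a then (1 : K) else 0)) := by
      rw [LinearMap.mem_ker, wedgeP, LinearMap.comp_apply, Submodule.subtype_apply, LinearMap.mulRight_apply]; exact hE
    rw [ker_wedgeP_of_window_ne K (s := 0) (Nat.zero_le _) (by rw [Nat.add_zero, if_pos rfl]; exact one_ne_zero),
      Submodule.mem_comap, Submodule.subtype_apply, show a + (k - a) = k by omega] at hker
    exact hker

/-- **THE NAMED FORM ON P¹: `(⋂_i (SI_k ⊔ Φs λ_i (xRich(k, P_i)))) ⊓ (SI_k ⊔ yRich(k, P∞)) = SI_k`** for distinct `λ_i`, `k + P_i ≤ n`, `k + P∞ ≤ n` and total order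
`Σ_i (P_i+1) + (P∞+1) ≥ k + 1` — F3b's intersection of node kernels is the Siegel ideal as soon as the total order reaches `k + 1`, with NO upper bound `D ≤ n + 1 − k`. -/
theorem iInf_sup_inf_sup_yRich_eq_siegelIdeal {k r : ℕ} {lam : Fin r → K} (hlam : Function.Injective lam) {P : Fin r → ℕ} {Pinf : ℕ} (hkP : ∀ i, k + P i ≤ n)
    (hkPinf : k + Pinf ≤ n) (hD : k + 1 ≤ (∑ i, (P i + 1)) + (Pinf + 1)) :
    (⨅ i, siegelIdeal K n k ⊔ (xRich K n k (P i)).map (Φs K (n := n) (lam i)).toLinearMap) ⊓ (siegelIdeal K n k ⊔ yRich K n k Pinf) = siegelIdeal K n k := by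
  refine le_antisymm (fun θ hθ => ?_) (le_inf (le_iInf fun i => le_sup_left) le_sup_left)
  obtain ⟨hfin, htop⟩ := Submodule.mem_inf.mp hθ
  rw [Submodule.mem_iInf] at hfin
  have hθk : θ ∈ ⋀[K]^k (In n → K) :=
    (sup_le (siegelIdeal_le_exteriorPower K k) (yRich_le_exteriorPower K k Pinf)) htop
  refine mem_siegelIdeal_of_forall_mul_node_top_eq_zero K (by omega) hlam hD hθk (fun i t => ?_) (fun t ht => ?_)
  · exact (mem_Kr.mp (sup_map_Φs_xRich_le_Kr_w_expMul_spike K (lam i) (P := P i) (t := (t : ℕ)) (by have := t.2; omega)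
      (by have := t.2; have := hkP i; omega) (hfin i))).2
  · exact (mem_Kr.mp (sup_yRich_le_Kr_w_spike_top K ht (by omega) htop)).2

/-- **THE CLASS FORM ON P¹: `(⋂_i Kr(univ, w_n(expMul λ_i q_i), k)) ⊓ Kr(univ, w_n(rev_n q∞), k) = SI_k`** for distinct `λ_i`, exact orders `P_i` (`k + P_i ≤ n`), `q∞` of exact order `P∞`
(`k + P∞ ≤ n`), total order `≥ k + 1`. -/
theorem iInf_Kr_w_expMul_inf_Kr_w_rev_eq_siegelIdeal {k r : ℕ} {lam : Fin r → K} (hlam : Function.Injective lam) {P : Fin r → ℕ} {q : Fin r → ℕ → K}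
    (hq : ∀ i j, P i < j → q i j = 0) (hqP : ∀ i, q i (P i) ≠ 0) (hkP : ∀ i, k + P i ≤ n) {Pinf : ℕ} {qinf : ℕ → K} (hqi : ∀ j, Pinf < j → qinf j = 0)
    (hqiP : qinf Pinf ≠ 0) (hkPinf : k + Pinf ≤ n) (hD : k + 1 ≤ (∑ i, (P i + 1)) + (Pinf + 1)) :
    (⨅ i, Kr K Finset.univ (w K n n (expMul K (lam i) (q i))) k) ⊓ Kr K Finset.univ (w K n n (rev K n qinf)) k = siegelIdeal K n k := by
  have e : ∀ i, Kr K Finset.univ (w K n n (expMul K (lam i) (q i))) k = siegelIdeal K n k ⊔ (xRich K n k (P i)).map (Φs K (n := n) (lam i)).toLinearMap :=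
    fun i => Kr_w_expMul_of_order K (lam i) (hkP i) (hq i) (hqP i)
  simp only [e]
  rw [Kr_w_rev_of_order K hkPinf hqi hqiP]
  exact iInf_sup_inf_sup_yRich_eq_siegelIdeal K hlam hkP hkPinf hD

/-! ## §96. The dual: the co-Siegel decomposition by any divisor on `P¹`, in every degree -/

/-- **A FINITE FAMILY WHOSE SUM HAS DIMENSION `Σ_i dim` IS INDEPENDENT** (generic dimension count). -/
theorem iSupIndep_of_finrank_iSup_eq_sum {M : Type*} [AddCommGroup M] [Module K M] [FiniteDimensional K M] {ι : Type*} [Fintype ι]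
    (F : ι → Submodule K M) (htot : finrank K ↥(⨆ i, F i) = ∑ i, finrank K (F i)) : iSupIndep F := by
  classical
  intro i
  have hrest_eq : (⨆ (j) (_ : j ≠ i), F j) = (Finset.univ.erase i).sup F := by
    rw [Finset.sup_eq_iSup]
    refine iSup_congr fun j => ?_
    by_cases hj : j = i
    · subst hj; simp
    · simp [hj]
  have hfs : ∀ s : Finset ι, finrank K ↥(s.sup F) ≤ ∑ j ∈ s, finrank K (F j) := by
    intro s
    induction s using Finset.induction_on with
    | empty => rw [Finset.sup_empty, finrank_bot, Finset.sum_empty]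
    | insert a s ha ih =>
      rw [Finset.sup_insert, Finset.sum_insert ha]
      exact (Submodule.finrank_add_le_finrank_add_finrank _ _).trans (Nat.add_le_add_left ih _)
  have hrest : finrank K ↥(⨆ (j) (_ : j ≠ i), F j) ≤ ∑ j ∈ Finset.univ.erase i, finrank K (F j) := by rw [hrest_eq]; exact hfs _
  have hsplit : (⨆ j, F j) = F i ⊔ ⨆ (j) (_ : j ≠ i), F j := by
    apply le_antisymm
    · refine iSup_le fun j => ?_
      by_cases hj : j = i
      · subst hj; exact le_sup_left
      · exact (le_iSup₂ (f := fun j (_ : j ≠ i) => F j) j hj).trans le_sup_right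
    · exact sup_le (le_iSup F i) (iSup₂_le fun j _ => le_iSup F j)
  have hsum : ∑ j, finrank K (F j) = finrank K (F i) + ∑ j ∈ Finset.univ.erase i, finrank K (F j) :=
    (Finset.add_sum_erase _ _ (Finset.mem_univ i)).symm
  have hdim := Submodule.finrank_sup_add_finrank_inf_eq (F i) (⨆ (j) (_ : j ≠ i), F j)
  rw [← hsplit, htot, hsum] at hdim
  have h0 : finrank K ↥(F i ⊓ ⨆ (j) (_ : j ≠ i), F j) = 0 := by omega
  rw [disjoint_iff, Submodule.finrank_eq_zero.mp h0]

/-- **THE CO-SIEGEL SPACE IS THE SUM OF THE NODE IMAGES OF ANY DIVISOR ON P¹ OF TOTAL ORDER `≥ k + 1`, IN EVERY DEGREE**: `k + k′ = n`, distinct `λ_i`, exact orders `P_i ≤ k′`,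
`q∞` of exact order `P∞ ≤ k′`, `Σ_i (P_i+1) + (P∞+1) ≥ k + 1` ⇒ **`coSiegel(k′+n) = (⨆_i V(univ, w_n(expMul λ_i q_i), k′)) ⊔ V(univ, w_n(rev_n q∞), k′)`** — F6's
`coSiegel_eq_iSup_V_sup_V_rev` needed `2k ≤ n` and total order exactly `k + 1`. -/
theorem coSiegel_eq_iSup_V_sup_V_rev' {k k' r : ℕ} (hkk' : k + k' = n) {lam : Fin r → K} (hlam : Function.Injective lam) {P : Fin r → ℕ} {q : Fin r → ℕ → K}
    (hq : ∀ i j, P i < j → q i j = 0) (hqP : ∀ i, q i (P i) ≠ 0) (hPk' : ∀ i, P i ≤ k') {Pinf : ℕ} {qinf : ℕ → K} (hqi : ∀ j, Pinf < j → qinf j = 0)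
    (hqiP : qinf Pinf ≠ 0) (hPinfk' : Pinf ≤ k') (hD : k + 1 ≤ (∑ i, (P i + 1)) + (Pinf + 1)) :
    coSiegel K n (k' + n) = (⨆ i, V K (In n) Finset.univ (w K n n (expMul K (lam i) (q i))) k') ⊔ V K (In n) Finset.univ (w K n n (rev K n qinf)) k' := by
  set W := (⨆ i, V K (In n) Finset.univ (w K n n (expMul K (lam i) (q i))) k') ⊔ V K (In n) Finset.univ (w K n n (rev K n qinf)) k' with hW
  have hle : W ≤ coSiegel K n (k' + n) := sup_le (iSup_le fun i => V_w_le_coSiegel K hkk' _) (V_w_le_coSiegel K hkk' _)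
  -- Ann_k(W) = (⋂_i Kr_i) ⊓ Kr_∞ = SI_k
  have hAnn : Ann K k W = siegelIdeal K n k := by
    rw [hW, Ann_sup, ← Kr_w_eq_Ann K hkk', ← iInf_Kr_w_expMul_inf_Kr_w_rev_eq_siegelIdeal K hlam hq hqP (fun i => by have := hPk' i; omega) hqi hqiP
      (by omega) hD]
    rcases Nat.eq_zero_or_pos r with hr | hr
    · subst hr
      rw [iInf_of_empty, iSup_of_empty, Ann_bot, top_inf_eq]
      refine le_antisymm inf_le_right (le_inf ?_ le_rfl)
      rw [Kr_w_eq_Ann K hkk']; exact Ann_le_Hom K k _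
    · rw [Ann_iSup_V_w_eq_iInf_Kr K hkk' hr]
  symm
  refine Submodule.eq_of_le_of_finrank_eq hle ?_
  have h1 := finrank_Ann_add K (a := k) (b := k' + n) (I := In n) (by rw [Fintype.card_fin]; omega) (hle.trans (coSiegel_le_Hom K (k' + n)))
  rw [hAnn, Fintype.card_fin] at h1
  have h2 := finrank_siegelIdeal K (n := n) k
  rw [finrank_coSiegel K (show k + (k' + n) = n + n by omega)]
  omega

/-- **… DIRECT FOR TOTAL ORDER EXACTLY `k + 1`**: the finite node images are independent, add up to dimension `(Σ_i (P_i+1))·C(n,k)`, and meet the image of the node at `∞` in `0`. -/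
theorem coSiegel_decomposition_top {k k' r : ℕ} (hkk' : k + k' = n) {lam : Fin r → K} (hlam : Function.Injective lam) {P : Fin r → ℕ} {q : Fin r → ℕ → K}
    (hq : ∀ i j, P i < j → q i j = 0) (hqP : ∀ i, q i (P i) ≠ 0) (hPk' : ∀ i, P i ≤ k') {Pinf : ℕ} {qinf : ℕ → K} (hqi : ∀ j, Pinf < j → qinf j = 0)
    (hqiP : qinf Pinf ≠ 0) (hPinfk' : Pinf ≤ k') (hD : (∑ i, (P i + 1)) + (Pinf + 1) = k + 1) :
    iSupIndep (fun i => V K (In n) Finset.univ (w K n n (expMul K (lam i) (q i))) k') ∧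
      finrank K ↥(⨆ i, V K (In n) Finset.univ (w K n n (expMul K (lam i) (q i))) k') = (∑ i, (P i + 1)) * n.choose k ∧
      Disjoint (⨆ i, V K (In n) Finset.univ (w K n n (expMul K (lam i) (q i))) k') (V K (In n) Finset.univ (w K n n (rev K n qinf)) k') := by
  classical
  set F : Fin r → Submodule K (HT K (In n)) := fun i => V K (In n) Finset.univ (w K n n (expMul K (lam i) (q i))) k' with hF
  set Vi := V K (In n) Finset.univ (w K n n (rev K n qinf)) k' with hVi
  have hchoose : n.choose k' = n.choose k := by rw [← Nat.choose_symm (show k ≤ n by omega), show n - k = k' by omega]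
  have hPi : ∀ i, P i + 1 ≤ ∑ j, (P j + 1) := fun i => Finset.single_le_sum (fun j _ => Nat.zero_le (P j + 1)) (Finset.mem_univ i)
  have hdimF : ∀ i, finrank K (F i) = (P i + 1) * n.choose k := fun i => by
    rw [← hchoose]; exact finrank_V_w_expMul_of_order K (lam i) (hPk' i) (by have := hPi i; omega) (hq i) (hqP i)
  have hdimVi : finrank K Vi = (Pinf + 1) * n.choose k := by
    rw [← hchoose]; exact finrank_V_w_rev_of_order K hPinfk' (by omega) hqi hqiP
  have hsumF : ∑ i, finrank K (F i) = (∑ i, (P i + 1)) * n.choose k := by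
    rw [Finset.sum_congr rfl fun i _ => hdimF i, Finset.sum_mul]
  have hfs : ∀ s : Finset (Fin r), finrank K ↥(s.sup F) ≤ ∑ j ∈ s, finrank K (F j) := by
    intro s
    induction s using Finset.induction_on with
    | empty => rw [Finset.sup_empty, finrank_bot, Finset.sum_empty]
    | insert a s ha ih =>
      rw [Finset.sup_insert, Finset.sum_insert ha]
      exact (Submodule.finrank_add_le_finrank_add_finrank _ _).trans (Nat.add_le_add_left ih _)
  have hsupF : finrank K ↥(⨆ i, F i) ≤ (∑ i, (P i + 1)) * n.choose k := by
    rw [← hsumF, ← Finset.sup_univ_eq_iSup]; exact hfs _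
  have htot : finrank K ↥((⨆ i, F i) ⊔ Vi) = (k + 1) * n.choose k := by
    rw [hF, hVi, ← coSiegel_eq_iSup_V_sup_V_rev' K hkk' hlam hq hqP hPk' hqi hqiP hPinfk' hD.ge, finrank_coSiegel K (show k + (k' + n) = n + n by omega)]
  have hdim := Submodule.finrank_sup_add_finrank_inf_eq (⨆ i, F i) Vi
  rw [htot, hdimVi] at hdim
  have hsupF_eq : finrank K ↥(⨆ i, F i) = (∑ i, (P i + 1)) * n.choose k := by
    have : (k + 1) * n.choose k = (∑ i, (P i + 1)) * n.choose k + (Pinf + 1) * n.choose k := by rw [← hD, Nat.add_mul]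
    omega
  have h0 : finrank K ↥((⨆ i, F i) ⊓ Vi) = 0 := by
    have : (k + 1) * n.choose k = (∑ i, (P i + 1)) * n.choose k + (Pinf + 1) * n.choose k := by rw [← hD, Nat.add_mul]
    omega
  refine ⟨iSupIndep_of_finrank_iSup_eq_sum K F (by rw [hsupF_eq, hsumF]), hsupF_eq, ?_⟩
  rw [disjoint_iff, Submodule.finrank_eq_zero.mp h0]

end Summit.Ventures.HSemireg.Wedge.KernelDuality
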